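import Literature.FieldTheory.AlgClosed.AutStableSubspaceDescent
import Mathlib.LinearAlgebra.Pi
import Mathlib.Data.Complex.Basic
import HarnessLib

/-!
# The cocharacter dichotomy behind Moonen–Zarhin 1999, Prop. (4.2): a `ℤ`-spanned subspace of `A₁ × A₂`
# (`Aᵢ ≅ ℂ²` the Lie algebra of the norm-one torus `U_{Fᵢ}` of a quartic CM field, read on its four eigenlines)
# that carries the Hodge vector and a 4-CYCLE Galois symmetry on each side is ALL of `A₁ × A₂` or the GRAPH of a
# permutation of the eigenlines

Layer `Literature/LinearAlgebra`, namespace `Literature.LinearAlgebra.CMSurfacePair`; lane `lit-hodgefound` (Track 2 foundations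
library), prover seat `lit-hodgefound-p17` (generation 53, self-proposed row g53-#1).  PURE LINEAR ALGEBRA on `ℂ^{ι₁ ⊕ ι₂}` — no
Hodge theory, no tori; THEOREMS ONLY (no definition, no instance, no notation, no named fact; D-0026 net debt 0).  The consumer
(`Literature/Geometry/Kaehler/ComplexTorusSimpleCMSurfacesProductHodgeGroup`, g53-#3) instantiates it on
`L = {z | P diag(z) P⁻¹ ∈ Lie Hg(Y₁ × Y₂)(ℂ)}` for two simple complex abelian surfaces `Y₁, Y₂` with complex multiplication, read
in common eigenframes `P = P₁ ⊕ P₂` of `End⁰(Yᵢ) ⊗ ℂ`.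

## Source, verbatim, and what is abstracted

B. Moonen, Yu. G. Zarhin, *Hodge classes on abelian varieties of low dimension*, Math. Ann. **315** (1999) 711–733, held
`paper:arxiv-math_9901113`, §4 Proposition (4.2) (materialised text p0008 L11–L14): «Let `X₁` and `X₂` be two simple abelian
surfaces with CM by the same quartic CM-field `F`. Suppose `X₁` and `X₂` are not isogenous. Write `X = X₁ × X₂`. Then
`Hg(X) = Hg(X₁) × Hg(X₂)`.»  Proof (p0008 L16–L65): `U_F` is `ℚ`-simple with splitting field the degree-8 closure `L`,
`Gal(L/ℚ) ≅ D₄`, `End(U_F) = ℤ`; «Assume that `Hg(X) ≠ Hg(X₁) × Hg(X₂)`. The fact that `U_F` is `ℚ`-simple implies that both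
surjective projection maps `Hg(X) → Hg(Xᵢ)` are isogenies […] `J₂ = (n/m) · J₁` […] `m = ±n` […] `J₁ = ±J₂`. This implies that
`X₁` and `X₂` are isogenous».  In §5 (5.5) (p0009 L103–L106) the Proposition is also invoked for two simple CM surfaces with CM
by DIFFERENT fields.

Here the torus-theoretic content is isolated as linear algebra on cocharacters.  For a simple CM surface `Y` with the four
eigenlines `V_j` (`j ∈ ι`, `#ι = 4`) of `End⁰(Y) ⊗ ℂ` paired by `π` (`V_j ⟂ V_k` unless `k = π j`), `Lie Hg(Y)(ℂ) = Lie U_F(ℂ)`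
is `A = {z : ι → ℂ | z ∘ π = -z}` (eigenvalue coordinates), the Hodge vector `J/i` is a SIGN vector `s ∈ A` (`s = 1` on the CM
type `Φ = {j₀, j₀'}`, `-1` on `Φ̄`), `Aut(ℂ)` permutes the eigenlines, and — because the quartic CM field of a SIMPLE CM surface
contains no imaginary quadratic field — some automorphism acts as the 4-CYCLE `j₀ ↦ j₀' ↦ π j₀ ↦ π j₀'` (this is where
Moonen–Zarhin's «`U_F` is `ℚ`-simple», Lemma (3.7), lives).  For the product, `L = Lie Hg(Y₁ × Y₂)(ℂ) ⊆ A₁ × A₂` projects onto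
both factors, is spanned by INTEGER vectors (`Lie T = X_*(T) ⊗ ℂ` for the torus `Hg(Y₁ × Y₂)(ℂ)`), is carried to itself by the
eigenline permutations of every `σ ∈ Aut(ℂ)` (on integer vectors), and contains `s = (s₁, s₂)`.

## What is proved (all hypotheses explicit; `z (inl j)`, `z (inr m)` are the two blocks of `z : ι₁ ⊕ ι₂ → ℂ`)

* §0 `four_points` (a fixed-point-free involution `π` on a 4-set and a `π`-antisymmetric sign vector with `s j₀ = s j₀' = 1`,
  `j₀ ≠ j₀'`: `ι = {j₀, j₀', π j₀, π j₀'}`), `comp_mem_of_le_span_int` ∕ `ringEquiv_comp_mem_of_le_span_int` (a `ℤ`-spanned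
  subspace stable on integer vectors under a coordinate map is stable outright, and is stable under `Aut(ℂ)` coordinatewise).
* §1 **`forall_eq_zero_or_forall_elim_mem`** — THE KERNEL DICHOTOMY («both projections are isogenies», the `ℚ`-simplicity step):
  with a 4-cycle on the second factor, either `{z ∈ L | z|₁ = 0} = 0` or `0 × A₂ ⊆ L` (Galois descent makes the kernel rational;
  a rational line stable under a rotation of order 4 is impossible; a rational plane is everything).
* §2 `forall_mem_of_forall_elim_mem` (`0 × A₂ ⊆ L` and `L ↠ A₁` ⟹ `L = A₁ × A₂`) and **`exists_forall_apply_inr_eq`** — THE GRAPH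
  STEP (Moonen–Zarhin's `J₂ = (n/m) J₁ ⟹ m = ±n`): if `{z ∈ L | z|₁ = 0} = 0` then, with `a = s + s∘g`, `b = s - s∘g` for the
  4-cycle symmetry `g` of the first factor, every `z ∈ L` is `(z_{j₀}/2) a + (z_{j₀'}/2) b`, whence a map `β : ι₂ → ι₁` with
  `z (inr m) = z (inl (β m))` for all `z ∈ L`.
* §3 **`forall_mem_or_exists_forall_apply_inr_eq`** — THE DICHOTOMY: `L = A₁ × A₂`, or `L` lies in the graph of the line map `β`.

## References

* [MoonenZarhin1999LowDim] B. Moonen, Yu. G. Zarhin, Math. Ann. 315 (1999), §4 (4.1), Prop. (4.2) and its proof; §3 Lemma (3.7);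
  §5 (5.5).
* [Borel1991] A. Borel, *Linear Algebraic Groups*, 2nd ed., AG §14.2 (Galois descent of subspaces), §8.11 (`k`-tori).
* [Springer1998] T. A. Springer, *Linear Algebraic Groups*, 2nd ed., 3.2.10 (4), 4.4.13 (`Lie T = k ⊗ X_*(T)`), 13.1.1.
-/

noncomputable section

open Function Cardinal

namespace Literature.LinearAlgebra

namespace CMSurfacePair

open Literature.FieldTheory.AlgClosed (Complex.submodule_le_span_fixed_of_forall_ringEquiv)

/-! ### §0 Four points; integer spans -/

section FourPoints

variable {ι : Type*} [Fintype ι] [DecidableEq ι]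

/-- **The four eigenlines.**  If `π` is an involution of a 4-element set and `t` is a `π`-antisymmetric vector with
`t j₀ = t j₀' = 1`, `j₀ ≠ j₀'`, then `j₀, j₀', π j₀, π j₀'` are pairwise distinct and exhaust the set (the CM type
`Φ = {j₀, j₀'}` and its conjugate `Φ̄ = π Φ`). [cite: MoonenZarhin1999LowDim, §4 (4.1) (`Σ_F = Φ ⨿ Φ̄` for a quartic CM field)] -/
theorem four_points (hcard : Fintype.card ι = 4) {π : ι → ι} (hπ : Involutive π) {t : ι → ℂ}
    (ht : ∀ j, t (π j) = -t j) {j₀ j₀' : ι} (hj : j₀ ≠ j₀') (h₀ : t j₀ = 1) (h₀' : t j₀' = 1) :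
    (π j₀ ≠ j₀ ∧ π j₀ ≠ j₀' ∧ π j₀' ≠ j₀ ∧ π j₀' ≠ j₀' ∧ π j₀ ≠ π j₀') ∧
      ∀ j, j = j₀ ∨ j = j₀' ∨ j = π j₀ ∨ j = π j₀' := by
  have hm1 : (-1 : ℂ) ≠ 1 := by norm_num
  have hπ₀ : t (π j₀) = -1 := by rw [ht, h₀]
  have hπ₀' : t (π j₀') = -1 := by rw [ht, h₀']
  have h1 : π j₀ ≠ j₀ := fun h ↦ hm1 (by rw [← hπ₀, h, h₀])
  have h2 : π j₀ ≠ j₀' := fun h ↦ hm1 (by rw [← hπ₀, h, h₀'])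
  have h3 : π j₀' ≠ j₀ := fun h ↦ hm1 (by rw [← hπ₀', h, h₀])
  have h4 : π j₀' ≠ j₀' := fun h ↦ hm1 (by rw [← hπ₀', h, h₀'])
  have h5 : π j₀ ≠ π j₀' := fun h ↦ hj (hπ.injective h)
  refine ⟨⟨h1, h2, h3, h4, h5⟩, fun j ↦ ?_⟩
  have hS : ({j₀, j₀', π j₀, π j₀'} : Finset ι) = Finset.univ := by
    apply Finset.eq_univ_of_card
    have hc : ({j₀, j₀', π j₀, π j₀'} : Finset ι).card = 4 := by
      rw [Finset.card_insert_of_notMem (by simp [hj, h1.symm, h3.symm]),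
        Finset.card_insert_of_notMem (by simp [h2.symm, h4.symm]),
        Finset.card_insert_of_notMem (by simp [h5]), Finset.card_singleton]
    rw [hc, hcard]
  have hj' := Finset.mem_univ j
  rw [← hS] at hj'
  simpa only [Finset.mem_insert, Finset.mem_singleton] using hj'

/-- A `π`-antisymmetric vector on the four points is determined by its values on the CM type `{j₀, j₀'}`:
`w = w(j₀) (e_{j₀} - e_{π j₀}) + w(j₀') (e_{j₀'} - e_{π j₀'})`. [cite: MoonenZarhin1999LowDim, §4 (4.1)] -/
theorem eq_of_antisymm_four (hcard : Fintype.card ι = 4) {π : ι → ι} (hπ : Involutive π) {t : ι → ℂ}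
    (ht : ∀ j, t (π j) = -t j) {j₀ j₀' : ι} (hj : j₀ ≠ j₀') (h₀ : t j₀ = 1) (h₀' : t j₀' = 1)
    {w : ι → ℂ} (hw : ∀ j, w (π j) = -w j) (j : ι) :
    w j = w j₀ * ((Pi.single j₀ 1 : ι → ℂ) j - (Pi.single (π j₀) 1 : ι → ℂ) j) +
      w j₀' * ((Pi.single j₀' 1 : ι → ℂ) j - (Pi.single (π j₀') 1 : ι → ℂ) j) := by
  obtain ⟨⟨h1, h2, h3, h4, h5⟩, hex⟩ := four_points hcard hπ ht hj h₀ h₀'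
  rcases hex j with rfl | rfl | rfl | rfl
  · simp [h1.symm, hj, h3.symm]
  · simp [hj.symm, h2.symm, h4.symm]
  · simp [h1, h2, h5, hw]
  · simp [h3, h4, h5.symm, hw]

end FourPoints

section Spans

variable {κ : Type*} {L : Submodule ℂ (κ → ℂ)}

/-- **A `ℤ`-spanned subspace is stable under a coordinate substitution as soon as its integer vectors are carried into it**
(`z ↦ z ∘ e` is linear). [cite: Springer1998, 3.2.10 (4) and 4.4.13 (`Lie T = k ⊗ X_*(T)`)] -/
theorem comp_mem_of_le_span_int (hint : L ≤ Submodule.span ℂ {z | z ∈ L ∧ ∀ x, ∃ n : ℤ, z x = n}) (e : κ → κ)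
    (he : ∀ z ∈ L, (∀ x, ∃ n : ℤ, z x = n) → z ∘ e ∈ L) {z : κ → ℂ} (hz : z ∈ L) : z ∘ e ∈ L := by
  suffices h : ∀ y ∈ Submodule.span ℂ {z | z ∈ L ∧ ∀ x, ∃ n : ℤ, z x = n}, y ∘ e ∈ L from h z (hint hz)
  intro y₀ hy₀
  induction hy₀ using Submodule.span_induction with
  | mem y hy => exact he y hy.1 hy.2
  | zero => exact L.zero_mem
  | add y y' _ _ hy hy' =>
    have h : (y + y') ∘ e = y ∘ e + y' ∘ e := rfl
    rw [h]
    exact L.add_mem hy hy'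
  | smul c y _ hy =>
    have h : (c • y) ∘ e = c • (y ∘ e) := rfl
    rw [h]
    exact L.smul_mem c hy

/-- **A `ℤ`-spanned subspace of `ℂ^κ` is stable under every automorphism of `ℂ` acting on the coordinates** (integer vectors are
fixed; `σ(c z) = σ(c) σ(z)`). [cite: Borel1991, AG §14.2] -/
theorem ringEquiv_comp_mem_of_le_span_int (hint : L ≤ Submodule.span ℂ {z | z ∈ L ∧ ∀ x, ∃ n : ℤ, z x = n}) (σ : ℂ ≃+* ℂ)
    {z : κ → ℂ} (hz : z ∈ L) : (⇑σ ∘ z) ∈ L := by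
  suffices h : ∀ y ∈ Submodule.span ℂ {z | z ∈ L ∧ ∀ x, ∃ n : ℤ, z x = n}, (⇑σ ∘ y) ∈ L from h z (hint hz)
  intro y₀ hy₀
  induction hy₀ using Submodule.span_induction with
  | mem y hy =>
    have h : (⇑σ ∘ y) = y := by
      funext x
      obtain ⟨n, hn⟩ := hy.2 x
      rw [comp_apply, hn, map_intCast]
    rw [h]
    exact hy.1
  | zero =>
    have h : (⇑σ ∘ (0 : κ → ℂ)) = 0 := by funext x; simp
    rw [h]
    exact L.zero_mem
  | add y y' _ _ hy hy' =>
    have h : (⇑σ ∘ (y + y')) = (⇑σ ∘ y) + (⇑σ ∘ y') := by funext x; simp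
    rw [h]
    exact L.add_mem hy hy'
  | smul c y _ hy =>
    have h : (⇑σ ∘ (c • y)) = σ c • (⇑σ ∘ y) := by funext x; simp
    rw [h]
    exact L.smul_mem (σ c) hy

/-- The prime field `ℚ ⊆ ℂ` is countable. [folklore] -/
private theorem cardinalMk_fieldRange_ratCast_le : #((Rat.castHom ℂ).fieldRange) ≤ ℵ₀ := by
  rw [Cardinal.mk_le_aleph0_iff]
  exact (Set.countable_range (Rat.castHom ℂ)).to_subtype

/-- **A non-zero `Aut(ℂ)`-stable subspace of `ℂ^κ` contains a non-zero RATIONAL vector** (Galois descent, `ℂ^{Aut(ℂ)} = ℚ`).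
[cite: Borel1991, AG §14.2] -/
theorem exists_rat_ne_zero_of_forall_ringEquiv [Fintype κ] (V : Submodule ℂ (κ → ℂ))
    (hV : ∀ σ : ℂ ≃+* ℂ, ∀ v ∈ V, (⇑σ ∘ v) ∈ V) {z : κ → ℂ} (hz : z ∈ V) (hz0 : z ≠ 0) :
    ∃ w ∈ V, w ≠ 0 ∧ ∀ x, ∃ q : ℚ, w x = q := by
  have hle := Complex.submodule_le_span_fixed_of_forall_ringEquiv (Rat.castHom ℂ).fieldRange
    cardinalMk_fieldRange_ratCast_le V (fun σ _ v hv ↦ hV σ v hv)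
  by_contra hne
  push Not at hne
  have hbot : Submodule.span ℂ {w : κ → ℂ | w ∈ V ∧ ∀ i, w i ∈ (Rat.castHom ℂ).fieldRange} = ⊥ := by
    refine Submodule.span_eq_bot.2 fun w hw ↦ ?_
    by_contra hw0
    obtain ⟨x, hx⟩ := hne w hw.1 hw0
    obtain ⟨q, hq⟩ := RingHom.mem_fieldRange.1 (hw.2 x)
    exact hx q (by rw [← hq]; rfl)
  have h := hle hz
  rw [hbot, Submodule.mem_bot] at h
  exact hz0 h

end Spans

/-! ### §1 The kernel dichotomy (`U_F` is `ℚ`-simple: both projections of a non-split `Hg(Y₁ × Y₂)` are isogenies) -/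

section Kernel

variable {ι₁ ι₂ : Type*} [Fintype ι₁] [Fintype ι₂] {L : Submodule ℂ (ι₁ ⊕ ι₂ → ℂ)}

/-- **THE KERNEL DICHOTOMY.**  Let `L ⊆ ℂ^{ι₁ ⊕ ι₂}` be `ℤ`-spanned, `π₂`-antisymmetric in the second block, and carried into
itself by a coordinate symmetry `(g₁, g₂)` whose second component is the 4-CYCLE `m₀ ↦ m₀' ↦ π₂ m₀ (↦ π₂ m₀')` through a CM type
`{m₀, m₀'}` of the second factor (`#ι₂ = 4`).  Then either the kernel `{z ∈ L | z|₁ = 0}` of the first projection vanishes, or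
`L ⊇ 0 × A₂` (`A₂` = all `π₂`-antisymmetric vectors).  [The kernel is `Aut(ℂ)`-stable, hence has a non-zero RATIONAL vector `w`
if it is non-zero; `α w + β (w∘g)` and `β w - α (w∘g)` (`α = w_{m₀}`, `β = w_{m₀'}`) are `(α² + β²)`-multiples of
`e_{m₀} - e_{π m₀}` and `e_{m₀'} - e_{π m₀'}`, and `α² + β² ≠ 0` over `ℚ` — Moonen–Zarhin's «`U_F` is `ℚ`-simple … both
surjective projection maps `Hg(X) → Hg(X_i)` are isogenies».]
[cite: MoonenZarhin1999LowDim, §4 proof of Prop. (4.2) (p0008 L47–L49) and §3 Lemma (3.7)] [cite: Borel1991, AG §14.2 and §8.11] -/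
theorem forall_eq_zero_or_forall_elim_mem [DecidableEq ι₂] (hcard : Fintype.card ι₂ = 4) {π₂ : ι₂ → ι₂} (hπ : Involutive π₂)
    {t : ι₂ → ℂ} (ht : ∀ m, t (π₂ m) = -t m) {m₀ m₀' : ι₂} (hm : m₀ ≠ m₀') (ht₀ : t m₀ = 1) (ht₀' : t m₀' = 1)
    (hL₂ : ∀ z ∈ L, ∀ m, z (.inr (π₂ m)) = -z (.inr m))
    (hint : L ≤ Submodule.span ℂ {z | z ∈ L ∧ ∀ x, ∃ n : ℤ, z x = n})
    {g₁ : ι₁ → ι₁} {g₂ : ι₂ → ι₂} (hstab : ∀ z ∈ L, z ∘ Sum.map g₁ g₂ ∈ L)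
    (hgπ : ∀ m, g₂ (π₂ m) = π₂ (g₂ m)) (hg₀ : g₂ m₀ = m₀') (hg₀' : g₂ m₀' = π₂ m₀) :
    (∀ z ∈ L, (∀ j, z (.inl j) = 0) → z = 0) ∨
      ∀ w : ι₂ → ℂ, (∀ m, w (π₂ m) = -w m) → Sum.elim (0 : ι₁ → ℂ) w ∈ L := by
  classical
  obtain ⟨⟨h1, h2, h3, h4, h5⟩, hex⟩ := four_points hcard hπ ht hm ht₀ ht₀'
  by_cases hK : ∀ z ∈ L, (∀ j, z (.inl j) = 0) → z = 0
  · exact Or.inl hK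
  right
  push Not at hK
  obtain ⟨z, hzL, hz0, hzne⟩ := hK
  -- the kernel `V = {z ∈ L | z|₁ = 0}` is `Aut(ℂ)`-stable, hence has a non-zero rational vector
  let V : Submodule ℂ (ι₁ ⊕ ι₂ → ℂ) := L ⊓ LinearMap.ker (LinearMap.funLeft ℂ ℂ (Sum.inl : ι₁ → ι₁ ⊕ ι₂))
  have hV : ∀ y, y ∈ V ↔ y ∈ L ∧ ∀ j, y (.inl j) = 0 := by
    intro y
    simp only [V, Submodule.mem_inf, LinearMap.mem_ker, funext_iff, LinearMap.funLeft_apply, Pi.zero_apply]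
  have hVst : ∀ σ : ℂ ≃+* ℂ, ∀ v ∈ V, (⇑σ ∘ v) ∈ V := by
    intro σ v hv
    rw [hV] at hv ⊢
    exact ⟨ringEquiv_comp_mem_of_le_span_int hint σ hv.1, fun j ↦ by rw [comp_apply, hv.2 j, map_zero]⟩
  obtain ⟨w, hwV, hw0, hwq⟩ := exists_rat_ne_zero_of_forall_ringEquiv V hVst ((hV z).2 ⟨hzL, hz0⟩) hzne
  obtain ⟨hwL, hw1⟩ := (hV w).1 hwV
  have hwπ : ∀ m, w (.inr (π₂ m)) = -w (.inr m) := hL₂ w hwL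
  obtain ⟨α, hα⟩ := hwq (.inr m₀)
  obtain ⟨β, hβ⟩ := hwq (.inr m₀')
  have hwg : w ∘ Sum.map g₁ g₂ ∈ L := hstab w hwL
  have hdecw : ∀ m, w (.inr m) = w (.inr m₀) * ((Pi.single m₀ 1 : ι₂ → ℂ) m - (Pi.single (π₂ m₀) 1 : ι₂ → ℂ) m) +
      w (.inr m₀') * ((Pi.single m₀' 1 : ι₂ → ℂ) m - (Pi.single (π₂ m₀') 1 : ι₂ → ℂ) m) := fun m ↦
    eq_of_antisymm_four hcard hπ ht hm ht₀ ht₀' (w := fun m ↦ w (.inr m)) hwπ m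
  -- `w` does not vanish on the CM type `{m₀, m₀'}`
  have hαβ : ((α : ℂ) ^ 2 + (β : ℂ) ^ 2) ≠ 0 := by
    intro h
    have hq : α ^ 2 + β ^ 2 = 0 := by exact_mod_cast h
    have hα0 : α = 0 := by nlinarith [sq_nonneg α, sq_nonneg β]
    have hβ0 : β = 0 := by nlinarith [sq_nonneg α, sq_nonneg β]
    apply hw0
    funext x
    rcases x with j | m
    · exact hw1 j
    · rw [Pi.zero_apply, hdecw m, hα, hβ, hα0, hβ0]
      push_cast
      ring
  -- the two rational combinations isolate `e_{m₀} - e_{π m₀}` and `e_{m₀'} - e_{π m₀'}`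
  set u : ι₁ ⊕ ι₂ → ℂ := Sum.elim 0 ((Pi.single m₀ 1 : ι₂ → ℂ) - Pi.single (π₂ m₀) 1) with hu
  set u' : ι₁ ⊕ ι₂ → ℂ := Sum.elim 0 ((Pi.single m₀' 1 : ι₂ → ℂ) - Pi.single (π₂ m₀') 1) with hu'
  have hcomb : (α : ℂ) • w + (β : ℂ) • (w ∘ Sum.map g₁ g₂) = ((α : ℂ) ^ 2 + (β : ℂ) ^ 2) • u := by
    funext x
    rcases x with j | m
    · simp [hu, hw1]
    · simp only [Pi.add_apply, Pi.smul_apply, comp_apply, Sum.map_inr, smul_eq_mul, hu, Sum.elim_inr, Pi.sub_apply]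
      rcases hex m with rfl | rfl | rfl | rfl
      · rw [hg₀, ← hα, ← hβ]
        simp [h1.symm]
        ring
      · rw [hg₀', hwπ, ← hα, ← hβ]
        simp [hm.symm, h2.symm]
        ring
      · rw [hgπ, hg₀, hwπ, hwπ, ← hα, ← hβ]
        simp [h1]
        ring
      · rw [hgπ, hg₀', hπ m₀, hwπ, ← hα, ← hβ]
        simp [h3, h5.symm]
        ring
  have hcomb' : (β : ℂ) • w - (α : ℂ) • (w ∘ Sum.map g₁ g₂) = ((α : ℂ) ^ 2 + (β : ℂ) ^ 2) • u' := by
    funext x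
    rcases x with j | m
    · simp [hu', hw1]
    · simp only [Pi.sub_apply, Pi.smul_apply, comp_apply, Sum.map_inr, smul_eq_mul, hu', Sum.elim_inr]
      rcases hex m with rfl | rfl | rfl | rfl
      · rw [hg₀, ← hα, ← hβ]
        simp [hm, h3.symm]
        ring
      · rw [hg₀', hwπ, ← hα, ← hβ]
        simp [h4.symm]
        ring
      · rw [hgπ, hg₀, hwπ, hwπ, ← hα, ← hβ]
        simp [h2, h5]
        ring
      · rw [hgπ, hg₀', hπ m₀, hwπ, ← hα, ← hβ]
        simp [h4]
        ring
  have huL : u ∈ L := by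
    have h := L.add_mem (L.smul_mem (α : ℂ) hwL) (L.smul_mem (β : ℂ) hwg)
    rw [hcomb] at h
    exact (L.smul_mem_iff hαβ).1 h
  have hu'L : u' ∈ L := by
    have h := L.sub_mem (L.smul_mem (β : ℂ) hwL) (L.smul_mem (α : ℂ) hwg)
    rw [hcomb'] at h
    exact (L.smul_mem_iff hαβ).1 h
  intro v hv
  have hdec : Sum.elim (0 : ι₁ → ℂ) v = v m₀ • u + v m₀' • u' := by
    funext x
    rcases x with j | m
    · simp [hu, hu']
    · simp only [Pi.add_apply, Pi.smul_apply, smul_eq_mul, hu, hu', Sum.elim_inr, Pi.sub_apply]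
      exact eq_of_antisymm_four hcard hπ ht hm ht₀ ht₀' hv m
  rw [hdec]
  exact L.add_mem (L.smul_mem _ huL) (L.smul_mem _ hu'L)

end Kernel

/-! ### §2 The full case and the graph case -/

section Graph

variable {ι₁ ι₂ : Type*} {L : Submodule ℂ (ι₁ ⊕ ι₂ → ℂ)}

/-- **The full case: `0 × A₂ ⊆ L` and `L ↠ A₁` give `L = A₁ × A₂`** (`dim Hg(X) = dim Hg(X₁) + dim K₂`).
[cite: MoonenZarhin1999LowDim, §3 (3.1)] -/
theorem forall_mem_of_forall_elim_mem {π₁ : ι₁ → ι₁} {π₂ : ι₂ → ι₂}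
    (hL₂ : ∀ z ∈ L, ∀ m, z (.inr (π₂ m)) = -z (.inr m))
    (hsurj₁ : ∀ w : ι₁ → ℂ, (∀ j, w (π₁ j) = -w j) → ∃ z ∈ L, ∀ j, z (.inl j) = w j)
    (h : ∀ w : ι₂ → ℂ, (∀ m, w (π₂ m) = -w m) → Sum.elim (0 : ι₁ → ℂ) w ∈ L)
    (z : ι₁ ⊕ ι₂ → ℂ) (hz₁ : ∀ j, z (.inl (π₁ j)) = -z (.inl j)) (hz₂ : ∀ m, z (.inr (π₂ m)) = -z (.inr m)) :
    z ∈ L := by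
  obtain ⟨y, hyL, hy⟩ := hsurj₁ (fun j ↦ z (.inl j)) (fun j ↦ hz₁ j)
  have hw : ∀ m, (fun m ↦ z (.inr m) - y (.inr m)) (π₂ m) = -(fun m ↦ z (.inr m) - y (.inr m)) m := fun m ↦ by
    simp only [hz₂, hL₂ y hyL]
    ring
  have hdec : z = y + Sum.elim (0 : ι₁ → ℂ) (fun m ↦ z (.inr m) - y (.inr m)) := by
    funext x
    rcases x with j | m
    · simp [hy]
    · simp
  rw [hdec]
  exact L.add_mem hyL (h _ hw)

/-- **THE GRAPH STEP** («`J₂ = (n/m) · J₁` … `m = ±n` … `J₁ = ±J₂`», read on cocharacters).  Suppose the kernel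
`{z ∈ L | z|₁ = 0}` vanishes, `L` is `π₁`-antisymmetric in the first block (`#ι₁ = 4`), contains a sign vector `s` with
`s = 1` on the CM type `{j₀, j₀'}` of the first factor, and contains `s ∘ g` for a coordinate symmetry `g = (g₁, g₂)` whose first
component is the 4-cycle `j₀ ↦ j₀' ↦ π₁ j₀`.  Then `a = s + s∘g`, `b = s - s∘g` restrict to `2(e_{j₀} - e_{π j₀})`,
`2(e_{j₀'} - e_{π j₀'})` on the first block, every `z ∈ L` equals `(z_{j₀}/2) a + (z_{j₀'}/2) b`, and reading the second block
gives a line map `β : ι₂ → ι₁` with `z (inr m) = z (inl (β m))` for all `z ∈ L`: `L` sits in the graph of an eigenline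
identification.  [cite: MoonenZarhin1999LowDim, §4 proof of Prop. (4.2) (p0008 L52–L65)] -/
theorem exists_forall_apply_inr_eq [Fintype ι₁] [DecidableEq ι₁] (hcard : Fintype.card ι₁ = 4) {π₁ : ι₁ → ι₁} (hπ : Involutive π₁)
    (hL₁ : ∀ z ∈ L, ∀ j, z (.inl (π₁ j)) = -z (.inl j))
    {s : ι₁ ⊕ ι₂ → ℂ} (hs : s ∈ L) (hsv : ∀ x, s x = 1 ∨ s x = -1)
    {g₁ : ι₁ → ι₁} {g₂ : ι₂ → ι₂} (hsg : s ∘ Sum.map g₁ g₂ ∈ L) (hgπ : ∀ j, g₁ (π₁ j) = π₁ (g₁ j))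
    {j₀ j₀' : ι₁} (hj : j₀ ≠ j₀') (hs₀ : s (.inl j₀) = 1) (hs₀' : s (.inl j₀') = 1)
    (hg₀ : g₁ j₀ = j₀') (hg₀' : g₁ j₀' = π₁ j₀)
    (hK : ∀ z ∈ L, (∀ j, z (.inl j) = 0) → z = 0) :
    ∃ β : ι₂ → ι₁, ∀ z ∈ L, ∀ m, z (.inr m) = z (.inl (β m)) := by
  classical
  have hsπ : ∀ j, s (.inl (π₁ j)) = -s (.inl j) := hL₁ s hs
  obtain ⟨-, hex⟩ := four_points hcard hπ (t := fun j ↦ s (.inl j)) hsπ hj hs₀ hs₀'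
  have hne : (1 : ℂ) ≠ -1 := by norm_num
  refine ⟨fun m ↦ if s (.inr m) = s (.inr (g₂ m)) then (if s (.inr m) = 1 then j₀ else π₁ j₀)
    else (if s (.inr m) = 1 then j₀' else π₁ j₀'), fun z hz m ↦ ?_⟩
  -- `z = (z_{j₀}/2) a + (z_{j₀'}/2) b` with `a = s + s∘g`, `b = s - s∘g`
  have hz' : z - (z (.inl j₀) / 2) • (s + s ∘ Sum.map g₁ g₂) - (z (.inl j₀') / 2) • (s - s ∘ Sum.map g₁ g₂) = 0 := by
    refine hK _ (L.sub_mem (L.sub_mem hz (L.smul_mem _ (L.add_mem hs hsg))) (L.smul_mem _ (L.sub_mem hs hsg))) fun j ↦ ?_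
    simp only [Pi.sub_apply, Pi.add_apply, Pi.smul_apply, comp_apply, Sum.map_inl, smul_eq_mul]
    rcases hex j with rfl | rfl | rfl | rfl
    · rw [hg₀, hs₀, hs₀']
      ring
    · rw [hg₀', hsπ, hs₀, hs₀']
      ring
    · rw [hgπ, hg₀, hsπ, hsπ, hs₀, hs₀', hL₁ z hz]
      ring
    · rw [hgπ, hg₀', hπ j₀, hsπ, hs₀, hs₀', hL₁ z hz]
      ring
  have hzm := congrFun hz' (.inr m)
  simp only [Pi.sub_apply, Pi.add_apply, Pi.smul_apply, comp_apply, Sum.map_inr, smul_eq_mul, Pi.zero_apply] at hzm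
  dsimp only
  rcases hsv (.inr m) with h1m | h1m <;> rcases hsv (.inr (g₂ m)) with h2m | h2m
  · rw [show (if s (.inr m) = s (.inr (g₂ m)) then (if s (.inr m) = 1 then j₀ else π₁ j₀)
        else (if s (.inr m) = 1 then j₀' else π₁ j₀')) = j₀ by simp [h1m, h2m]]
    rw [h1m, h2m] at hzm
    linear_combination hzm
  · rw [show (if s (.inr m) = s (.inr (g₂ m)) then (if s (.inr m) = 1 then j₀ else π₁ j₀)
        else (if s (.inr m) = 1 then j₀' else π₁ j₀')) = j₀' by simp [h1m, h2m, hne]]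
    rw [h1m, h2m] at hzm
    linear_combination hzm
  · rw [show (if s (.inr m) = s (.inr (g₂ m)) then (if s (.inr m) = 1 then j₀ else π₁ j₀)
        else (if s (.inr m) = 1 then j₀' else π₁ j₀')) = π₁ j₀' by simp [h1m, h2m, hne.symm], hL₁ z hz]
    rw [h1m, h2m] at hzm
    linear_combination hzm
  · rw [show (if s (.inr m) = s (.inr (g₂ m)) then (if s (.inr m) = 1 then j₀ else π₁ j₀)
        else (if s (.inr m) = 1 then j₀' else π₁ j₀')) = π₁ j₀ by simp [h1m, h2m, hne.symm], hL₁ z hz]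
    rw [h1m, h2m] at hzm
    linear_combination hzm

end Graph

/-! ### §3 The dichotomy -/

section Main

variable {ι₁ ι₂ : Type*} [Fintype ι₁] [Fintype ι₂] [DecidableEq ι₁] [DecidableEq ι₂]
  {L : Submodule ℂ (ι₁ ⊕ ι₂ → ℂ)}

/-- **THE COCHARACTER DICHOTOMY (Moonen–Zarhin 1999, Prop. (4.2), torus-free core).**  Let `L ⊆ ℂ^{ι₁ ⊕ ι₂}` (`#ι₁ = #ι₂ = 4`,
`πᵢ` involutions) be a subspace which is `πᵢ`-antisymmetric in each block, surjects onto the antisymmetric vectors of the first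
block, is spanned by INTEGER vectors, contains a SIGN vector `s` (`±1`-valued), and whose integer vectors are carried into `L` by
two coordinate symmetries `(g₁, g₂)` and `(g₁', g₂')` commuting with the pairings, `g₁` acting on the first block as the 4-cycle
`j₀ ↦ j₀' ↦ π₁ j₀` through the CM type `{j₀, j₀'} = {s|₁ = 1}` and `g₂'` on the second block as the 4-cycle `m₀ ↦ m₀' ↦ π₂ m₀`
through `{m₀, m₀'} = {s|₂ = 1}`.  THEN either `L` contains EVERY vector antisymmetric in both blocks (`L = A₁ × A₂`:
`Hg(Y₁ × Y₂) = Hg(Y₁) × Hg(Y₂)`), or there is a line map `β : ι₂ → ι₁` with `z (inr m) = z (inl (β m))` for all `z ∈ L` and all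
`m` (the graph case, which for Hodge groups forces `Hom(Y₁, Y₂) ≠ 0`).
[cite: MoonenZarhin1999LowDim, §4 Prop. (4.2) and its proof (p0008 L11–L65); §5 (5.5)] [cite: Borel1991, §8.11 and AG §14.2] -/
theorem forall_mem_or_exists_forall_apply_inr_eq
    (hcard₁ : Fintype.card ι₁ = 4) (hcard₂ : Fintype.card ι₂ = 4) {π₁ : ι₁ → ι₁} {π₂ : ι₂ → ι₂}
    (hπ₁ : Involutive π₁) (hπ₂ : Involutive π₂)
    (hL₁ : ∀ z ∈ L, ∀ j, z (.inl (π₁ j)) = -z (.inl j)) (hL₂ : ∀ z ∈ L, ∀ m, z (.inr (π₂ m)) = -z (.inr m))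
    (hsurj₁ : ∀ w : ι₁ → ℂ, (∀ j, w (π₁ j) = -w j) → ∃ z ∈ L, ∀ j, z (.inl j) = w j)
    (hint : L ≤ Submodule.span ℂ {z | z ∈ L ∧ ∀ x, ∃ n : ℤ, z x = n})
    {s : ι₁ ⊕ ι₂ → ℂ} (hs : s ∈ L) (hsv : ∀ x, s x = 1 ∨ s x = -1)
    {g₁ : ι₁ → ι₁} {g₂ : ι₂ → ι₂} (hg : ∀ z ∈ L, (∀ x, ∃ n : ℤ, z x = n) → z ∘ Sum.map g₁ g₂ ∈ L)
    (hgπ : ∀ j, g₁ (π₁ j) = π₁ (g₁ j)) {j₀ j₀' : ι₁} (hj : j₀ ≠ j₀') (hs₀ : s (.inl j₀) = 1) (hs₀' : s (.inl j₀') = 1)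
    (hg₀ : g₁ j₀ = j₀') (hg₀' : g₁ j₀' = π₁ j₀)
    {g₁' : ι₁ → ι₁} {g₂' : ι₂ → ι₂} (hg' : ∀ z ∈ L, (∀ x, ∃ n : ℤ, z x = n) → z ∘ Sum.map g₁' g₂' ∈ L)
    (hgπ' : ∀ m, g₂' (π₂ m) = π₂ (g₂' m)) {m₀ m₀' : ι₂} (hm : m₀ ≠ m₀') (hsm₀ : s (.inr m₀) = 1)
    (hsm₀' : s (.inr m₀') = 1) (hgm₀ : g₂' m₀ = m₀') (hgm₀' : g₂' m₀' = π₂ m₀) :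
    (∀ z : ι₁ ⊕ ι₂ → ℂ, (∀ j, z (.inl (π₁ j)) = -z (.inl j)) → (∀ m, z (.inr (π₂ m)) = -z (.inr m)) → z ∈ L) ∨
      ∃ β : ι₂ → ι₁, ∀ z ∈ L, ∀ m, z (.inr m) = z (.inl (β m)) := by
  have hstab' : ∀ z ∈ L, z ∘ Sum.map g₁' g₂' ∈ L := fun z hz ↦ comp_mem_of_le_span_int hint _ hg' hz
  rcases forall_eq_zero_or_forall_elim_mem hcard₂ hπ₂ (t := fun m ↦ s (.inr m)) (hL₂ s hs) hm hsm₀ hsm₀' hL₂ hint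
      hstab' hgπ' hgm₀ hgm₀' with hK | hfull
  · right
    have hsint : ∀ x, ∃ n : ℤ, s x = n := fun x ↦ by
      rcases hsv x with h | h
      · exact ⟨1, by rw [h]; norm_num⟩
      · exact ⟨-1, by rw [h]; norm_num⟩
    exact exists_forall_apply_inr_eq hcard₁ hπ₁ hL₁ hs hsv (hg s hs hsint) hgπ hj hs₀ hs₀' hg₀ hg₀' hK
  · left
    exact fun z hz₁ hz₂ ↦ forall_mem_of_forall_elim_mem hL₂ hsurj₁ hfull z hz₁ hz₂

end Main

end CMSurfacePair

end Literature.LinearAlgebra
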